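import Literature.NumberTheory.EllipticCurves.TateCurve.WeierstrassPQExpansion
import HarnessLib

/-!
# The `q`-expansion of `℘'` (Silverman, *Advanced Topics*, Prop. I.6.2 / Thm. V.1.1) — PROVED

Topic `Literature/NumberTheory/EllipticCurves/TateCurve`, namespace
`Literature.NumberTheory.EllipticCurves.TateCurve` (abc-iut cell, TRANCHE-T1 P21; sub-lemma U-1b
of the discharge plan of the named fact `uniformization`).

For `τ ∈ ℍ`, `0 < Im z < Im τ`, `u = e^{2πiz}`, `q = e^{2πiτ}`, `V(t) = t(1 + t)/(1 − t)³`: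

  `℘'_{ℤτ+ℤ}(z) = (2πi)³ · Σ_{n ∈ ℤ} V(qⁿu)`

(`derivWeierstrassP_ofUpperHalfPlane_eq`; Silverman ATAEC V §1, PDF p. 385:
"`(2πi)^{-3}℘'(u,q) = Σ_{n∈ℤ} qⁿu(1 + qⁿu)/(1 − qⁿu)³`"). Same route as for `℘`
(`WeierstrassPQExpansion.lean`): Mathlib's `℘' = −2 Σ_l (z − l)⁻³` (`hasSum_derivWeierstrassP`)
summed row by row, each row a Lipschitz sum for cubes,
`Σ_{d ∈ ℤ} (w + d)⁻³ = ((−2πi)³/2) Σ n² tⁿ = ((−2πi)³/2) V(t)` (`tsum_int_one_div_add_cube_of_im_ne_zero`,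
from Mathlib `EisensteinSeries.qExpansion_identity` at `k = 2` and `Σ n² tⁿ = t(1+t)/(1−t)³`),
valid for `Im w ≠ 0` thanks to `V(t⁻¹) = −V(t)`.

## References
* [SilvermanATAEC1994] J. H. Silverman, *Advanced Topics in the Arithmetic of Elliptic Curves*,
  GTM 151, Springer 1994, Prop. I.6.2 and Ch. V §1, Thm. V.1.1 (PDF pp. 385–386).
-/

noncomputable section

open Complex Real Filter Topology
open UpperHalfPlane hiding I
open scoped PeriodPair

namespace Literature.NumberTheory.EllipticCurves.TateCurve

/-- `V(t) = t(1 + t)/(1 − t)³`, the summand of `(2πi)^{-3}℘'` (Silverman ATAEC V §1, p. 385).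
[cite: SilvermanATAEC1994, Thm. V.1.1 (proof, PDF p. 385)] -/
def vFun (t : ℂ) : ℂ := t * (1 + t) / (1 - t) ^ 3

/-- `V(t⁻¹) = −V(t)`. [cite: SilvermanATAEC1994, Thm. V.1.1 (proof, PDF p. 385)] -/
theorem vFun_inv (t : ℂ) : vFun t⁻¹ = -vFun t := by
  rcases eq_or_ne t 0 with rfl | ht
  · simp [vFun]
  rcases eq_or_ne t 1 with rfl | ht1
  · simp [vFun]
  have h1 : (1 - t) ≠ 0 := sub_ne_zero.mpr (Ne.symm ht1)
  have h2 : (1 - t⁻¹) ≠ 0 := by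
    rw [sub_ne_zero, ne_eq, eq_comm, inv_eq_one]; exact ht1
  rw [vFun, vFun]
  field_simp
  ring

/-- `Σ_{n ≥ 0} n² tⁿ = t(1+t)/(1−t)³ = V(t)` for `‖t‖ < 1` (from Mathlib's
`Σ C(n+k,k) tⁿ = (1−t)^{−k−1}`: `n² = 2·C(n+2,2) − 3·C(n+1,1) + C(n,0)`). [folklore] -/
private theorem hasSum_sq_mul_geometric {t : ℂ} (ht : ‖t‖ < 1) :
    HasSum (fun n : ℕ ↦ (n : ℂ) ^ 2 * t ^ n) (vFun t) := by
  have h2 := hasSum_choose_mul_geometric_of_norm_lt_one 2 ht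
  have h1 := hasSum_choose_mul_geometric_of_norm_lt_one 1 ht
  have h0 := hasSum_choose_mul_geometric_of_norm_lt_one 0 ht
  have h := ((h2.mul_left 2).sub (h1.mul_left 3)).add h0
  have ht1 : (1 - t) ≠ 0 := by
    intro h0'
    have : t = 1 := (sub_eq_zero.mp h0').symm
    rw [this, norm_one] at ht
    exact lt_irrefl _ ht
  have key : ∀ n : ℕ, (n : ℂ) ^ 2 * t ^ n =
      2 * ((((n + 2).choose 2 : ℕ) : ℂ) * t ^ n) - 3 * ((((n + 1).choose 1 : ℕ) : ℂ) * t ^ n)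
        + (((n + 0).choose 0 : ℕ) : ℂ) * t ^ n := by
    intro n
    rw [Nat.cast_choose_two, Nat.choose_one_right, Nat.choose_zero_right]
    push_cast
    ring
  have hv : vFun t = 2 * (1 / (1 - t) ^ (2 + 1)) - 3 * (1 / (1 - t) ^ (1 + 1))
      + 1 / (1 - t) ^ (0 + 1) := by
    simp only [vFun]
    field_simp
    ring
  rw [hv]
  exact h.congr_fun fun n ↦ key n

/-- **Lipschitz's formula for `k = 3`:** for `Im w > 0`, `Σ_{d ∈ ℤ} (w + d)⁻³ = ((−2πi)³/2) V(t)`,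
`t = e^{2πiw}`. [cite: SilvermanATAEC1994, Thm. V.1.1 (proof, PDF pp. 385–386)] -/
theorem tsum_int_one_div_add_cube (w : ℍ) :
    ∑' d : ℤ, 1 / ((w : ℂ) + d) ^ 3 =
      (-2 * π * I) ^ 3 / 2 * vFun (cexp (2 * π * I * w)) := by
  have h := EisensteinSeries.qExpansion_identity (k := 2) (by norm_num) w
  have hq : ‖cexp (2 * π * I * w)‖ < 1 := norm_exp_two_pi_I_lt_one w
  rw [show (2 + 1 : ℕ) = 3 from rfl] at h
  rw [h, (hasSum_sq_mul_geometric hq).tsum_eq, Nat.factorial_two, Nat.cast_ofNat]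

/-- The cube row sum for `Im w ≠ 0`: `Σ_{d ∈ ℤ} (w + d)⁻³ = ((−2πi)³/2) V(e^{2πiw})` (for `Im w < 0`
via `w ↦ −w`, `d ↦ −d`, `(−x)³ = −x³` and `V(t⁻¹) = −V(t)`).
[cite: SilvermanATAEC1994, Thm. V.1.1 (proof, PDF pp. 385–386)] -/
theorem tsum_int_one_div_add_cube_of_im_ne_zero {w : ℂ} (hw : w.im ≠ 0) :
    ∑' d : ℤ, 1 / (w + d) ^ 3 = (-2 * π * I) ^ 3 / 2 * vFun (cexp (2 * π * I * w)) := by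
  rcases lt_or_gt_of_ne hw with h | h
  · have hw' : 0 < (-w).im := by simpa using h
    have h' := tsum_int_one_div_add_cube ⟨-w, hw'⟩
    rw [UpperHalfPlane.coe_mk] at h'
    have hre : ∑' d : ℤ, 1 / (w + d) ^ 3 = -∑' d : ℤ, 1 / (-w + d) ^ 3 := by
      rw [← (Equiv.neg ℤ).tsum_eq, ← tsum_neg]
      refine tsum_congr fun d ↦ ?_
      simp only [Equiv.neg_apply, Int.cast_neg]
      rw [show (w + -(d : ℂ)) = -(-w + d) by ring, neg_pow, show ((-1 : ℂ)) ^ 3 = -1 by norm_num,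
        neg_one_mul, div_neg]
    rw [hre, h', show (2 * π * I * -w) = -(2 * π * I * w) by ring, Complex.exp_neg, vFun_inv]
    ring
  · exact tsum_int_one_div_add_cube ⟨w, h⟩

/-- Summability of a cube row `d ↦ (w + d)⁻³`. [folklore] -/
private theorem summable_one_div_add_cube (w : ℂ) : Summable fun d : ℤ ↦ 1 / (w + d) ^ 3 := by
  have h := EisensteinSeries.linear_right_summable w 1 (k := 3) (by norm_num)
  refine h.congr fun d ↦ ?_
  simp [zpow_ofNat, one_div]

/-- `‖V(t)‖ ≤ 12‖t‖` for `‖t‖ ≤ 1/2`. [folklore] -/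
private theorem norm_vFun_le {t : ℂ} (ht : ‖t‖ ≤ 1 / 2) : ‖vFun t‖ ≤ 12 * ‖t‖ := by
  rw [vFun, norm_div, norm_mul, norm_pow]
  have h1 : 1 / 2 ≤ ‖1 - t‖ := by
    have h := norm_sub_norm_le (1 : ℂ) t
    rw [norm_one] at h
    linarith
  have h2 : 1 / 8 ≤ ‖1 - t‖ ^ 3 := by
    have := pow_le_pow_left₀ (by norm_num) h1 3
    norm_num at this
    exact this
  have h3 : ‖1 + t‖ ≤ 3 / 2 := by
    have := norm_add_le (1 : ℂ) t
    rw [norm_one] at this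
    linarith
  have ht0 : 0 ≤ ‖t‖ := norm_nonneg _
  calc ‖t‖ * ‖1 + t‖ / ‖1 - t‖ ^ 3 ≤ ‖t‖ * (3 / 2) / (1 / 8) := by
        gcongr
    _ = 12 * ‖t‖ := by ring

/-- `n ↦ V(qⁿ v)` is summable for `‖q‖ < 1`. [folklore] -/
private theorem summable_vFun_pow_mul {q : ℂ} (hq : ‖q‖ < 1) (v : ℂ) :
    Summable fun n : ℕ ↦ vFun (q ^ n * v) := by
  have ht : Tendsto (fun n : ℕ ↦ ‖q ^ n * v‖) atTop (𝓝 0) := by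
    have := ((tendsto_pow_atTop_nhds_zero_of_norm_lt_one hq).mul_const v).norm
    simpa using this
  obtain ⟨N, hN⟩ := eventually_atTop.mp (ht.eventually (Iic_mem_nhds (by norm_num : (0:ℝ) < 1/2)))
  rw [← summable_nat_add_iff N]
  refine Summable.of_norm_bounded (g := fun n : ℕ ↦ 12 * (‖v‖ * ‖q‖ ^ N) * ‖q‖ ^ n) ?_ ?_
  · exact (summable_geometric_of_lt_one (norm_nonneg _) hq).mul_left _
  · intro n
    calc ‖vFun (q ^ (n + N) * v)‖ ≤ 12 * ‖q ^ (n + N) * v‖ := norm_vFun_le (hN _ (by omega))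
      _ = 12 * (‖v‖ * ‖q‖ ^ N) * ‖q‖ ^ n := by rw [norm_mul, norm_pow, pow_add]; ring

/-- `c ↦ V(q^c v)` is summable over `ℤ` for `‖q‖ < 1` (`V(q^{-n}v) = −V(qⁿv⁻¹)`): convergence of the
series for `(2πi)^{-3}℘'` of Silverman ATAEC V §1. [cite: SilvermanATAEC1994, Thm. V.1.1 (PDF p. 385)] -/
theorem summable_vFun_zpow_mul {q : ℂ} (hq : ‖q‖ < 1) (v : ℂ) :
    Summable fun c : ℤ ↦ vFun (q ^ c * v) := by
  refine Summable.of_nat_of_neg ?_ ?_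
  · simpa using summable_vFun_pow_mul hq v
  · have h := (summable_vFun_pow_mul hq v⁻¹).neg
    refine h.congr fun n ↦ ?_
    rw [← vFun_inv, zpow_neg, zpow_natCast, mul_inv, inv_inv]

variable (τ : ℍ)

/-- **The `q`-expansion of `℘'` (Silverman ATAEC Prop. I.6.2 / Thm. V.1.1), PROVED**: for
`τ ∈ ℍ` and `0 < Im z < Im τ`, with `u = e^{2πiz}`, `q = e^{2πiτ}`, `V(t) = t(1+t)/(1−t)³`,
`℘'_{ℤτ+ℤ}(z) = (2πi)³ Σ_{n ∈ ℤ} V(qⁿu)` — "`(2πi)^{-3}℘'(u,q) = Σ_{n∈ℤ} qⁿu(1+qⁿu)/(1−qⁿu)³`"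
(PDF p. 385). [cite: SilvermanATAEC1994, Thm. V.1.1 (PDF pp. 385–386)] -/
theorem derivWeierstrassP_ofUpperHalfPlane_eq {z : ℂ} (hz0 : 0 < z.im) (hz1 : z.im < τ.im) :
    ℘'[PeriodPair.ofUpperHalfPlane τ] z =
      (2 * π * I) ^ 3 * ∑' n : ℤ, vFun (cexp (2 * π * I * τ) ^ n * cexp (2 * π * I * z)) := by
  set L := PeriodPair.ofUpperHalfPlane τ with hL
  set q := cexp (2 * π * I * τ) with hq
  set u := cexp (2 * π * I * z) with hu
  set g : ℤ × ℤ → ℂ := fun p ↦ -2 / (z - (p.1 * (τ : ℂ) + p.2)) ^ 3 with hg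
  have hcoe : ∀ p : ℤ × ℤ, ((L.latticeEquivProd.symm.toEquiv p : L.lattice) : ℂ) =
      p.1 * (τ : ℂ) + p.2 := by
    intro p
    change ((L.latticeEquivProd.symm p : L.lattice) : ℂ) = _
    rw [PeriodPair.latticeEquiv_symm_apply]
    simp [hL]
  have hsum : HasSum g (℘'[L] z) := by
    have h := L.hasSum_derivWeierstrassP z
    rw [← (L.latticeEquivProd.symm.toEquiv).hasSum_iff] at h
    refine h.congr_fun fun p ↦ ?_
    simp only [hg, Function.comp_apply, hcoe]
  have him : ∀ c : ℤ, (z - c * (τ : ℂ)).im ≠ 0 := by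
    intro c hc
    simp only [Complex.sub_im, Complex.mul_im, Complex.intCast_re, UpperHalfPlane.coe_im,
      Complex.intCast_im, UpperHalfPlane.coe_re, zero_mul, add_zero] at hc
    have hτ := τ.im_pos
    rcases le_or_gt c 0 with hc0 | hc0
    · have : (c : ℝ) * τ.im ≤ 0 := mul_nonpos_of_nonpos_of_nonneg (by exact_mod_cast hc0) hτ.le
      linarith
    · have hc1 : (1 : ℝ) ≤ c := by exact_mod_cast hc0
      have : τ.im ≤ (c : ℝ) * τ.im := le_mul_of_one_le_left hτ.le hc1
      linarith
  -- row sums: `Σ_d -2/(w - d)³ = -2 Σ_d (w + d)⁻³ = (2πi)³ V(u q^{-c})`, `w = z - cτ`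
  have hrow : ∀ c : ℤ, ∑' d : ℤ, g (c, d) = (2 * π * I) ^ 3 * vFun (q ^ (-c) * u) := by
    intro c
    have e : ∀ d : ℤ, z - (c * (τ : ℂ) + d) = (z - c * τ) - d := fun d ↦ by ring
    have h1 : ∑' d : ℤ, g (c, d) = -2 * ∑' d : ℤ, 1 / ((z - c * (τ : ℂ)) + d) ^ 3 := by
      rw [← tsum_mul_left, ← (Equiv.neg ℤ).tsum_eq]
      refine tsum_congr fun d ↦ ?_
      simp only [hg, Equiv.neg_apply, Int.cast_neg]
      rw [show z - ((c : ℂ) * (τ : ℂ) + -(d : ℂ)) = (z - c * τ) + d by ring]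
      ring
    rw [h1, tsum_int_one_div_add_cube_of_im_ne_zero (him c)]
    have e2 : 2 * π * I * (z - c * (τ : ℂ)) = 2 * π * I * z + ((-c : ℤ) : ℂ) * (2 * π * I * τ) := by
      push_cast; ring
    rw [e2, Complex.exp_add, Complex.exp_int_mul, ← hq, ← hu, mul_comm u]
    ring
  have hdouble : ℘'[L] z = ∑' c : ℤ, ∑' d : ℤ, g (c, d) := by
    rw [← hsum.tsum_eq, hsum.summable.tsum_prod]
  have hq1 : ‖q‖ < 1 := norm_exp_two_pi_I_lt_one τ
  rw [hdouble]
  simp_rw [hrow]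
  rw [tsum_mul_left]
  congr 1
  rw [← (Equiv.neg ℤ).tsum_eq]
  exact tsum_congr fun c ↦ by simp

end Literature.NumberTheory.EllipticCurves.TateCurve

end
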